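import Summits.MatrixMultiplication.MatrixMultiplication.Theorems.RootDecomp1CartanDensityCore
import Summits.MatrixMultiplication.MatrixMultiplication.Theses.RootDecomp1

/-!
# LANDING NOTE — PART 2 of 2 (decomp-mm-lander-1 g1, 2026-08-30; mechanical split for the 400-line lint)

Source: lens-6 landing form `CartanDensityCore.lean` (sha256 `b62a53bb…7ece`, 532 lines).  PART 1 =
`Theorems/RootDecomp1CartanDensityCore.lean` (source lines 80–343, route-free); this part = source lines 344–528
(«Main theorems», «Sharpenings on the plane», «Named statements with witnesses»), copied byte-identically, plus the
imports of PART 1 and of `Theses.RootDecomp1`; the eleven witness theorems of the «Named statements» section received one-line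
docstrings (gate lint.docstring), nothing else changed.  The original module docstring follows unchanged.
-/

/-!
# Route `RootDecomp1`, leaf `FourThirdsLawAtThree`: asymptotic-rank laws on `ℂ³ ⊗ ℂ³ ⊗ ℂ³` are decided on the Cartan plane

LANDING FORM of the lens-6 generation-6 kernel `CartanDensity.lean` (sha256 `4836a2d9…`), cell `decomp-mm`,
lens 6 «barrier-complement carving», generation 7.  SUPPORTS the open leaf `FourThirdsLawAtThree`
(item `stmt-MatrixMultiplication-24511`) of `route-MatrixMultiplication-RootDecomp1`,

  `FourThirdsLawAtThree :⟺ ∀ T : Fin 3 → Fin 3 → Fin 3 → ℂ, R̃(T) ≤ 3^{4/3}`,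

WITHOUT closing it: every result below is an unconditional theorem, packaged (critic 2026-08-30T05:23:31Z)
as a NAMED `Prop` with its witness, so that the file audits as proved helpers + support (no orphan, no
`proof.conditional`).  The leaf itself stays OPEN (tag IDEA-NEEDED; finite-power border-rank instrument
NEGATIVE at Kronecker powers 2 and 3, census COSTUME-CENSUS v3 §I10/I10b).

**Theorem (Cartan universality, kernel-checked, classification-free).** Let
`𝔠 = {cartan w : w ∈ ℂ³}`, `cartan w (x,y,z) = [x+y+z = 0]·w(y−x)` — Nurmiev's normal form of the
semisimple `3 × 3 × 3` tensors, literally (`rfl`) the Hessian plane `u(a,b,c)` of route `HessianPlane`.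
The image of the polynomial map `Φ : (A, B, C, w) ↦ (A ⊗ B ⊗ C)·cartan w` (`famMap`) is Zariski dense in
`ℂ³ ⊗ ℂ³ ⊗ ℂ³` (`CartanFamilyZariskiDense`); indeed it contains a Euclidean neighbourhood of
`Φ(I,I,I,(1,−1,1))` (`CartanFamilyOpenImage`).  Consequently, for EVERY real `r`:

* `FormatThreeLawsOnCartanPlane`: `(∀ T ∈ ℂ³⊗ℂ³⊗ℂ³, R̃(T) ≤ r) ⟺ (∀ w ∈ ℂ³, R̃(cartan w) ≤ r)`;
* `FormatThreeLawsLocal`: a bound `R̃(cartan w) ≤ r` for all `w` in SOME neighbourhood of the single regular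
  point `w₀ = (1,−1,1)` already gives `R̃(T) ≤ r` for every `T`;
* `CartanSublevelClosed`, `FormatThreeLawsOnDenseSets`, `FormatThreeLawsGeneric`: the plane sublevel sets
  `{w | R̃(cartan w) ≤ r}` are closed (CHNVZ), so a bound on any DENSE set of plane points — e.g. off the zero
  set of any one non-zero polynomial `q(a,b,c)` (WLOG at REGULAR semisimple points only) — suffices;
* `FourThirdsLawAtThreeIffCartan` / `FourThirdsLawAtThreeIffPlane`: the leaf `FourThirdsLawAtThree` of
  `RootDecomp1` (the TREE declaration, by name) is EQUIVALENT to `∀ a b c : ℂ, R̃(u(a,b,c)) ≤ 3^{4/3}`;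
  `FourThirdsLawAtThreeCertificateForms`: its local / generic / dense sufficient forms (the shapes a
  future symbolic certificate over `ℂ(a,b,c)` would discharge);
* `SigmaThreeIffCartan`: the extended asymptotic rank conjecture at `d = 3` (`∀ T, R̃(T) ≤ 3`) is
  equivalent to its restriction to `𝔠` (the asymptotic-rank form of `HessianPlaneFlat`).

## Proof

The submersion-plus-identity-theorem mechanism of `Theorems/SoloInformedCwTwoPlusUnitUniversal.lean`
with the universal tensor replaced by the `3`-parameter family `cartan w = Σ_s w_s·X_s`
(`X_s(x,y,z) = [x+y+z = 0 ∧ y−x = s]`, `basis`):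

* every `Φ(M)` is a restriction of `cartan (M 3 0)` (`cartan_restrictsTo_famMap`), so
  `R̃(Φ M) ≤ R̃(cartan (M 3 0))` (tree theorem `asymptoticRank_le_of_polyDegeneratesTo`);
* SUBMERSION CERTIFICATE: `Φ : ℂ³⁶ → ℂ²⁷` (parameters `Fin 4 → Fin 3 → Fin 3 → ℂ`: `M 0 = A`, `M 1 = B`,
  `M 2 = C`, `M 3 0 = w`) has strict Fréchet derivative `V ↦ jacApply basis M V` (`hasStrictFDerivAt_famMap`);
  at the integer base point `M₀ = (I, I, I, (1,−1,1))` it is ONTO: `27` integer directions `W_{ijk}` with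
  `jacApply basisℤ M₀ W_{ijk} = 42·e_i ⊗ e_j ⊗ e_k`, checked by `decide +kernel` over `ℤ` (`cert`);
* inverse function theorem (`HasStrictFDerivAt.map_nhds_eq_of_surj`) ⇒ `Φ` is open at `M₀`; a polynomial
  vanishing on a neighbourhood vanishes identically (identity theorem on `ℂ²⁷`);
* CHNVZ (PROVED in the tree: `chnvz_zariskiClosed_asymptoticRank_le_holds`): `{R̃ ≤ r}` is Zariski closed.

No named fact, no `sorry`; axioms = the three standard ones. [cite: Vinberg1976; Nurmiev2000;
ChristandlHoeberechtsNieuwboerVranaZuiddam2025, Thm 1.2; BurgisserClausenShokrollahi1997, Problem 15.5]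
PROVER-READY landing form written by the decomp-mm lens-6 planner seat (gen 7); imports only BUILT modules.
-/

set_option linter.dupNamespace false

open scoped BigOperators Topology
open Filter Set

namespace Summit.MatrixMultiplication.MatrixMultiplication.Theorems.CartanDensity

open Literature.Computability.AlgebraicComplexity
open Literature.Barriers.MatrixMultiplication (asymptoticRank_le_of_polyDegeneratesTo)

noncomputable section

/-! ## Main theorems: laws on `ℂ³ ⊗ ℂ³ ⊗ ℂ³` are decided on `𝔠` -/

/-- **Cartan universality, local form.** If `R̃(cartan w) ≤ r` for all `w` in some neighbourhood of
the regular point `w₀ = (1,−1,1)`, then `R̃(T) ≤ r` for EVERY `T ∈ ℂ³ ⊗ ℂ³ ⊗ ℂ³`. -/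
theorem asymptoticRank_le_of_eventually_cartan {r : ℝ}
    (h : ∀ᶠ w in 𝓝 (![(1 : ℂ), -1, 1]), asymptoticRank (cartan w) ≤ r)
    (T : Fin 3 → Fin 3 → Fin 3 → ℂ) : asymptoticRank T ≤ r := by
  have hc : Tendsto (fun M : Param => M 3 0) (𝓝 basePoint) (𝓝 (![(1 : ℂ), -1, 1])) := by
    rw [← basePoint_plane]
    exact ((continuous_apply 0).comp (continuous_apply 3)).continuousAt
  have hM : ∀ᶠ M in 𝓝 basePoint, asymptoticRank (famMap M) ≤ r :=
    (hc.eventually h).mono fun M hM => (asymptoticRank_famMap_le M).trans hM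
  exact chnvz_zariskiClosed_asymptoticRank_le_holds ℂ (Fin 3) (Fin 3) (Fin 3) r T fun p hp =>
    eval_eq_zero_of_eventually_famMap p (hM.mono fun M hM => hp _ hM) T

/-- **Cartan universality.** `(∀ w, R̃(cartan w) ≤ r) → ∀ T ∈ ℂ³ ⊗ ℂ³ ⊗ ℂ³, R̃(T) ≤ r`. -/
theorem asymptoticRank_le_of_forall_cartan {r : ℝ}
    (h : ∀ w : Fin 3 → ℂ, asymptoticRank (cartan w) ≤ r) (T : Fin 3 → Fin 3 → Fin 3 → ℂ) :
    asymptoticRank T ≤ r :=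
  asymptoticRank_le_of_eventually_cartan (Filter.Eventually.of_forall h) T

/-! ## Sharpenings on the plane: closed sublevel sets, dense and generic subsets suffice -/

/-- `w ↦ cartan w` is continuous. -/
theorem continuous_cartan : Continuous cartan :=
  continuous_pi fun x => continuous_pi fun y => continuous_pi fun z => by
    by_cases h : x + y + z = 0
    · simpa [cartan, h] using continuous_apply (y - x)
    · simpa [cartan, h] using continuous_const

/-- The plane sublevel sets `{w | R̃(cartan w) ≤ r}` are closed (CHNVZ, Euclidean form). -/
theorem isClosed_cartan_le (r : ℝ) : IsClosed {w : Fin 3 → ℂ | asymptoticRank (cartan w) ≤ r} :=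
  (chnvz_zariskiClosed_asymptoticRank_le_holds.isClosed_complex r).preimage continuous_cartan

/-- **Dense-subset form.** A bound `R̃(cartan w) ≤ r` on a DENSE set of plane points gives `R̃(T) ≤ r`
for every `T ∈ ℂ³ ⊗ ℂ³ ⊗ ℂ³`. -/
theorem asymptoticRank_le_of_dense_cartan {r : ℝ} {D : Set (Fin 3 → ℂ)} (hD : Dense D)
    (h : ∀ w ∈ D, asymptoticRank (cartan w) ≤ r) (T : Fin 3 → Fin 3 → Fin 3 → ℂ) :
    asymptoticRank T ≤ r :=
  asymptoticRank_le_of_forall_cartan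
    (fun w => (isClosed_cartan_le r).closure_subset_iff.2 (fun w' hw' => h w' hw') (hD w)) T

/-- The non-vanishing locus of a non-zero polynomial on `ℂ³` is dense (identity theorem). -/
theorem dense_eval_ne_zero {q : MvPolynomial (Fin 3) ℂ} (hq : q ≠ 0) :
    Dense {w : Fin 3 → ℂ | MvPolynomial.eval w q ≠ 0} := by
  rw [dense_iff_inter_open]
  rintro U hU ⟨w₁, hw₁⟩
  by_contra hne
  have hzero : ∀ w ∈ U, MvPolynomial.eval w q = 0 := by
    intro w hw
    by_contra hw'
    exact hne ⟨w, hw, hw'⟩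
  have han : AnalyticOnNhd ℂ (fun w : Fin 3 → ℂ => MvPolynomial.eval w q) Set.univ :=
    AnalyticOnNhd.eval_mvPolynomial q
  have hev : (fun w : Fin 3 → ℂ => MvPolynomial.eval w q) =ᶠ[𝓝 w₁] 0 := by
    filter_upwards [hU.mem_nhds hw₁] with w hw
    exact hzero w hw
  have h := han.eqOn_zero_of_preconnected_of_eventuallyEq_zero isPreconnected_univ
    (Set.mem_univ _) hev
  exact hq (MvPolynomial.funext fun x => by simpa using h (Set.mem_univ x))

/-- **Generic-point form.** If `R̃(cartan w) ≤ r` for all `w` off the zero set of one non-zero polynomial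
`q` — e.g. off the `12` mirrors `abc·Π(a+ωⁱb+ωʲc) = 0`, i.e. at all REGULAR semisimple points — then
`R̃(T) ≤ r` for every `T ∈ ℂ³ ⊗ ℂ³ ⊗ ℂ³`. -/
theorem asymptoticRank_le_of_generic_cartan {r : ℝ} {q : MvPolynomial (Fin 3) ℂ} (hq : q ≠ 0)
    (h : ∀ w : Fin 3 → ℂ, MvPolynomial.eval w q ≠ 0 → asymptoticRank (cartan w) ≤ r)
    (T : Fin 3 → Fin 3 → Fin 3 → ℂ) : asymptoticRank T ≤ r :=
  asymptoticRank_le_of_dense_cartan (dense_eval_ne_zero hq) (fun w hw => h w hw) T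

/-! ## Named statements with witnesses (landing form) -/

/-- **Zariski density of `GL₃³ · 𝔠`**: a polynomial on `ℂ³ ⊗ ℂ³ ⊗ ℂ³` vanishing on every
`(A ⊗ B ⊗ C)·cartan w` is the zero polynomial. -/
def CartanFamilyZariskiDense : Prop :=
  ∀ p : MvPolynomial (Fin 3 × Fin 3 × Fin 3) ℂ,
    (∀ M : Param, MvPolynomial.eval (tensorEntries (famMap M)) p = 0) → p = 0

/-- Witness: the named statement `CartanFamilyZariskiDense` holds (its content and sources are in the docstring of `CartanFamilyZariskiDense`; docstring added at landing, lint.docstring). -/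
theorem cartanFamilyZariskiDense : CartanFamilyZariskiDense :=
  fun p hp => eq_zero_of_forall_famMap p hp

/-- **`Φ` is open at the base point**: the image of `(A,B,C,w) ↦ (A ⊗ B ⊗ C)·cartan w` is a Euclidean
neighbourhood of `Φ(I,I,I,(1,−1,1))`. -/
def CartanFamilyOpenImage : Prop := Set.range famMap ∈ 𝓝 (famMap basePoint)

/-- Witness: the named statement `CartanFamilyOpenImage` holds (its content and sources are in the docstring of `CartanFamilyOpenImage`; docstring added at landing, lint.docstring). -/
theorem cartanFamilyOpenImage : CartanFamilyOpenImage := range_famMap_mem_nhds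

/-- **Every asymptotic-rank law of format `3` is decided on the Cartan plane.** -/
def FormatThreeLawsOnCartanPlane : Prop :=
  ∀ r : ℝ, (∀ T : Fin 3 → Fin 3 → Fin 3 → ℂ, asymptoticRank T ≤ r) ↔
    ∀ w : Fin 3 → ℂ, asymptoticRank (cartan w) ≤ r

/-- Witness: the named statement `FormatThreeLawsOnCartanPlane` holds (its content and sources are in the docstring of `FormatThreeLawsOnCartanPlane`; docstring added at landing, lint.docstring). -/
theorem formatThreeLawsOnCartanPlane : FormatThreeLawsOnCartanPlane :=
  fun _ => ⟨fun h _ => h _, fun h => asymptoticRank_le_of_forall_cartan h⟩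

/-- **Local form**: a law holding at all plane points NEAR the single regular point `(1,−1,1)` holds for
every `3 × 3 × 3` tensor. -/
def FormatThreeLawsLocal : Prop :=
  ∀ r : ℝ, (∀ᶠ w in 𝓝 (![(1 : ℂ), -1, 1]), asymptoticRank (cartan w) ≤ r) →
    ∀ T : Fin 3 → Fin 3 → Fin 3 → ℂ, asymptoticRank T ≤ r

/-- Witness: the named statement `FormatThreeLawsLocal` holds (its content and sources are in the docstring of `FormatThreeLawsLocal`; docstring added at landing, lint.docstring). -/
theorem formatThreeLawsLocal : FormatThreeLawsLocal :=
  fun _ h T => asymptoticRank_le_of_eventually_cartan h T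

/-- **The plane sublevel sets `{w | R̃(cartan w) ≤ r}` are closed** (CHNVZ, Euclidean form). -/
def CartanSublevelClosed : Prop :=
  ∀ r : ℝ, IsClosed {w : Fin 3 → ℂ | asymptoticRank (cartan w) ≤ r}

/-- Witness: the named statement `CartanSublevelClosed` holds (its content and sources are in the docstring of `CartanSublevelClosed`; docstring added at landing, lint.docstring). -/
theorem cartanSublevelClosed : CartanSublevelClosed := isClosed_cartan_le

/-- **Dense-subset form**: a law holding on a DENSE set of plane points holds for every `3 × 3 × 3` tensor. -/
def FormatThreeLawsOnDenseSets : Prop :=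
  ∀ (r : ℝ) (D : Set (Fin 3 → ℂ)), Dense D → (∀ w ∈ D, asymptoticRank (cartan w) ≤ r) →
    ∀ T : Fin 3 → Fin 3 → Fin 3 → ℂ, asymptoticRank T ≤ r

/-- Witness: the named statement `FormatThreeLawsOnDenseSets` holds (its content and sources are in the docstring of `FormatThreeLawsOnDenseSets`; docstring added at landing, lint.docstring). -/
theorem formatThreeLawsOnDenseSets : FormatThreeLawsOnDenseSets :=
  fun _ _ hD h T => asymptoticRank_le_of_dense_cartan hD h T

/-- **Generic-point form**: a law holding off the zero set of ONE non-zero polynomial `q(a,b,c)` (e.g. at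
all regular semisimple points) holds for every `3 × 3 × 3` tensor. -/
def FormatThreeLawsGeneric : Prop :=
  ∀ (r : ℝ) (q : MvPolynomial (Fin 3) ℂ), q ≠ 0 →
    (∀ w : Fin 3 → ℂ, MvPolynomial.eval w q ≠ 0 → asymptoticRank (cartan w) ≤ r) →
      ∀ T : Fin 3 → Fin 3 → Fin 3 → ℂ, asymptoticRank T ≤ r

/-- Witness: the named statement `FormatThreeLawsGeneric` holds (its content and sources are in the docstring of `FormatThreeLawsGeneric`; docstring added at landing, lint.docstring). -/
theorem formatThreeLawsGeneric : FormatThreeLawsGeneric :=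
  fun _ _ hq h T => asymptoticRank_le_of_generic_cartan hq h T

/-- **Leaf `FourThirdsLawAtThree` (stmt-MatrixMultiplication-24511, the TREE declaration) ⟺ its Cartan
restriction.** -/
def FourThirdsLawAtThreeIffCartan : Prop :=
  Summit.MatrixMultiplication.MatrixMultiplication.Theses.RootDecomp1.FourThirdsLawAtThree ↔
    ∀ w : Fin 3 → ℂ, asymptoticRank (cartan w) ≤ (3 : ℝ) ^ (4 / 3 : ℝ)

/-- Witness: the named statement `FourThirdsLawAtThreeIffCartan` holds (its content and sources are in the docstring of `FourThirdsLawAtThreeIffCartan`; docstring added at landing, lint.docstring). -/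
theorem fourThirdsLawAtThreeIffCartan : FourThirdsLawAtThreeIffCartan :=
  formatThreeLawsOnCartanPlane _

/-- **Leaf `FourThirdsLawAtThree` in Hessian-plane coordinates**: `∀ a b c, R̃(u(a,b,c)) ≤ 3^{4/3}`, with
`u(a,b,c)` syntactically the plane point of `Theses/HessianPlane.lean` (`cartan ![a,b,c] = u(a,b,c)` is `rfl`). -/
def FourThirdsLawAtThreeIffPlane : Prop :=
  Summit.MatrixMultiplication.MatrixMultiplication.Theses.RootDecomp1.FourThirdsLawAtThree ↔
    ∀ a b c : ℂ, asymptoticRank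
      (fun x y z : Fin 3 => if x + y + z = 0 then ![a, b, c] (y - x) else (0 : ℂ)) ≤
        (3 : ℝ) ^ (4 / 3 : ℝ)

/-- Witness: the named statement `FourThirdsLawAtThreeIffPlane` holds (its content and sources are in the docstring of `FourThirdsLawAtThreeIffPlane`; docstring added at landing, lint.docstring). -/
theorem fourThirdsLawAtThreeIffPlane : FourThirdsLawAtThreeIffPlane := by
  unfold FourThirdsLawAtThreeIffPlane
  have hc : _ ↔ ∀ w : Fin 3 → ℂ, asymptoticRank (cartan w) ≤ (3 : ℝ) ^ (4 / 3 : ℝ) :=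
    fourThirdsLawAtThreeIffCartan
  rw [hc]
  constructor
  · intro h a b c
    exact h ![a, b, c]
  · intro h w
    rw [← cartan_eta]
    exact h (w 0) (w 1) (w 2)

/-- **Certificate forms of the leaf.** `FourThirdsLawAtThree` follows from a bound `R̃(cartan w) ≤ 3^{4/3}`
(i) on any neighbourhood of the regular point `(1,−1,1)`, or (ii) off the zero set of any one non-zero
polynomial `q(a,b,c)`, or (iii) on any dense set of plane points — the shapes a symbolic border-rank
certificate over `ℂ(a,b,c)` (valid where its denominators do not vanish) would discharge. -/
def FourThirdsLawAtThreeCertificateForms : Prop :=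
  ((∀ᶠ w in 𝓝 (![(1 : ℂ), -1, 1]), asymptoticRank (cartan w) ≤ (3 : ℝ) ^ (4 / 3 : ℝ)) →
      Summit.MatrixMultiplication.MatrixMultiplication.Theses.RootDecomp1.FourThirdsLawAtThree) ∧
  (∀ q : MvPolynomial (Fin 3) ℂ, q ≠ 0 →
    (∀ w : Fin 3 → ℂ, MvPolynomial.eval w q ≠ 0 →
      asymptoticRank (cartan w) ≤ (3 : ℝ) ^ (4 / 3 : ℝ)) →
      Summit.MatrixMultiplication.MatrixMultiplication.Theses.RootDecomp1.FourThirdsLawAtThree) ∧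
  (∀ D : Set (Fin 3 → ℂ), Dense D →
    (∀ w ∈ D, asymptoticRank (cartan w) ≤ (3 : ℝ) ^ (4 / 3 : ℝ)) →
      Summit.MatrixMultiplication.MatrixMultiplication.Theses.RootDecomp1.FourThirdsLawAtThree)

/-- Witness: the named statement `FourThirdsLawAtThreeCertificateForms` holds (its content and sources are in the docstring of `FourThirdsLawAtThreeCertificateForms`; docstring added at landing, lint.docstring). -/
theorem fourThirdsLawAtThreeCertificateForms : FourThirdsLawAtThreeCertificateForms :=
  ⟨fun h T => formatThreeLawsLocal _ h T,
   fun _ hq h T => formatThreeLawsGeneric _ _ hq h T,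
   fun _ hD h T => formatThreeLawsOnDenseSets _ _ hD h T⟩

/-- **`σ(3) = 1` ⟺ flat asymptotic rank on the Cartan plane**: the extended asymptotic rank conjecture
for `3 × 3 × 3` tensors is equivalent to its restriction to `𝔠` (the asymptotic-rank form of
`HessianPlaneFlat`; its consequence `ω = 2` is the tree theorem
`CwTwoPlusUnit.matrixMultiplication_of_sigma_three`). -/
def SigmaThreeIffCartan : Prop :=
  (∀ T : Fin 3 → Fin 3 → Fin 3 → ℂ, asymptoticRank T ≤ 3) ↔
    ∀ w : Fin 3 → ℂ, asymptoticRank (cartan w) ≤ 3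

/-- Witness: the named statement `SigmaThreeIffCartan` holds (its content and sources are in the docstring of `SigmaThreeIffCartan`; docstring added at landing, lint.docstring). -/
theorem sigmaThreeIffCartan : SigmaThreeIffCartan := formatThreeLawsOnCartanPlane 3

end

end Summit.MatrixMultiplication.MatrixMultiplication.Theorems.CartanDensity
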